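import Literature.NumberTheory.Transcendental.NesterenkoElimination
import Mathlib.Analysis.SpecialFunctions.Pow.Real
import HarnessLib

/-!
# Stub F of line `orbit-interpolation-determinant`, part I: arithmetic of the plane assembly (crux `ApproximationProperty`, stmt-Schanuel-6117)

Route `DiophantineDichotomy` (sub-problem `Schanuel/Schanuel`), crux
`Summit.Schanuel.Schanuel.Theses.DiophantineDichotomy.ApproximationProperty`, line
`orbit-interpolation-determinant`, skeleton v4, registered stub `stub_cycleAPI_two_of` (file
`DiophantineDichotomyApproximationPropertyCycleAPITwo.lean`). This helper file carries the
real-number bookkeeping of that assembly (budgets of LNM 1752 Ch. 3 Prop. 4.11 against the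
output-dependent target `exp(−(Δ h(J) + Y deg J)/c)` with `c = 4000(c₁ + c₂ + 1)` and the adaptive
height `h₂ = max(Y, Δ h(𝔭)/a)`), the floor facts for `b = ⌊Δ⌋`, `N = ⌊e^{h₂}⌋`, and two one-line
facts on associated primes and projective zeros. Proofs only; no definitions.
Sources: Nesterenko, LNM 1752 Ch. 3 §4 (Prop. 4.11); Philippon, J. Number Theory 81 (2000).
-/

set_option linter.dupNamespace false

noncomputable section

namespace Summit.Schanuel.Schanuel.Cruxes.ApproximationProperty.OrbitInterpolationDeterminant

open Literature.NumberTheory.Transcendental.Nesterenko Real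

namespace CycleAPITwo

/-! ## Real arithmetic of the assembly -/

/-- `K (k/c) ≤ K/80` when `80 k ≤ c`. [folklore] -/
theorem mul_div_le_div80 {K k c : ℝ} (hK : 0 ≤ K) (hc : 0 < c) (hk : 80 * k ≤ c) :
    K * (k / c) ≤ K / 80 := by
  rw [div_eq_mul_one_div K 80]
  refine mul_le_mul_of_nonneg_left ?_ hK
  rw [div_le_div_iff₀ hc (by norm_num)]
  linarith

/-- The common upper bound of the exponent `T + E` of the assembly: with `1 ≤ Δ/c`, `b ≤ Δ`,
`hR ≤ h₂`, `T + E ≤ 2(Δ/c)(hp Δ) + 2(Δ/c)(h₂ a) + 2(Δ/c)(25ab) + Yab/c`. [folklore] -/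
theorem exponent_le {c Δ Y a b hp hR h₂ : ℝ} (hc : 0 < c) (hcΔ : c ≤ Δ) (ha : 0 ≤ a)
    (hbΔ : b ≤ Δ) (hp0 : 0 ≤ hp) (hRh₂ : hR ≤ h₂)
    (hE0 : 0 ≤ hR * a + hp * b + 44 * a * b) :
    (Δ * (hp * b + hR * a + 6 * a * b) + Y * (a * b)) / c + (hR * a + hp * b + 44 * a * b) ≤
      2 * (Δ / c) * (hp * Δ) + 2 * (Δ / c) * (h₂ * a) + 2 * (Δ / c) * (25 * a * b) +
        Y * (a * b) / c := by
  have hcΔ1 : 1 ≤ Δ / c := by rw [le_div_iff₀ hc]; linarith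
  have hΔc0 : 0 ≤ Δ / c := by linarith
  have h1 : hR * a + hp * b + 44 * a * b ≤ Δ / c * (hR * a + hp * b + 44 * a * b) :=
    le_mul_of_one_le_left hE0 hcΔ1
  have hT : (Δ * (hp * b + hR * a + 6 * a * b) + Y * (a * b)) / c =
      Δ / c * (hp * b + hR * a + 6 * a * b) + Y * (a * b) / c := by
    field_simp
  have hpb : hp * b ≤ hp * Δ := mul_le_mul_of_nonneg_left hbΔ hp0
  have hRa : hR * a ≤ h₂ * a := mul_le_mul_of_nonneg_right hRh₂ ha
  have e : Δ / c * (hp * b + hR * a + 6 * a * b) + Δ / c * (hR * a + hp * b + 44 * a * b) =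
      Δ / c * (2 * (hp * b) + 2 * (hR * a) + 50 * a * b) := by ring
  have h2 : Δ / c * (2 * (hp * b) + 2 * (hR * a) + 50 * a * b) ≤
      Δ / c * (2 * (hp * Δ) + 2 * (h₂ * a) + 50 * a * b) :=
    mul_le_mul_of_nonneg_left (by linarith) hΔc0
  have e2 : Δ / c * (2 * (hp * Δ) + 2 * (h₂ * a) + 50 * a * b) =
      2 * (Δ / c) * (hp * Δ) + 2 * (Δ / c) * (h₂ * a) + 2 * (Δ / c) * (25 * a * b) := by ring
  rw [hT]
  linarith

/-- The accuracy budget for the SECOND form (adaptive height): with `80 c₂, 4000 ≤ c ≤ Δ ≤ Y ≤ h₂`,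
`Δ·hp ≤ a·h₂`, `1 ≤ a`, `b ≤ Δ ≤ 2b`, `hR ≤ h₂`, the exponent of Prop. 4.11 plus the target plus
`c₂ b` is at most `ab h₂/8`. [folklore] -/
theorem arith_R {c c₂ Δ Y a b hp hR h₂ : ℝ} (hc₂ : 0 < c₂) (hc₂c : 80 * c₂ ≤ c)
    (hc4000 : 4000 ≤ c) (hcΔ : c ≤ Δ) (hΔY : Δ ≤ Y) (hYh₂ : Y ≤ h₂) (hph₂ : Δ * hp ≤ a * h₂)
    (ha : 1 ≤ a) (hbΔ : b ≤ Δ) (hΔb : Δ ≤ 2 * b) (hp0 : 0 ≤ hp) (hR0 : 0 ≤ hR)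
    (hRh₂ : hR ≤ h₂) :
    (Δ * (hp * b + hR * a + 6 * a * b) + Y * (a * b)) / c + (hR * a + hp * b + 44 * a * b) +
        c₂ * b ≤ a * b * h₂ / 8 := by
  have hc : 0 < c := by linarith
  have hΔ0 : 0 < Δ := by linarith
  have ha0 : 0 < a := by linarith
  have hb0 : 0 < b := by linarith
  have hh₂0 : 0 ≤ h₂ := by linarith
  set K : ℝ := a * Δ * h₂ with hK
  have hK0 : 0 ≤ K := by positivity
  have hE0 : 0 ≤ hR * a + hp * b + 44 * a * b := by positivity
  have hexp := exponent_le (Y := Y) hc hcΔ ha0.le hbΔ hp0 hRh₂ hE0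
  -- the five terms against `K / 80`
  have t1 : c₂ * b ≤ K / 80 := by
    rw [le_div_iff₀ (by norm_num : (0:ℝ) < 80), hK]
    have e1 : c₂ * b ≤ c₂ * Δ := mul_le_mul_of_nonneg_left hbΔ hc₂.le
    have e2 : 80 * c₂ ≤ h₂ := by linarith
    have e3 : 80 * c₂ * Δ ≤ h₂ * Δ := mul_le_mul_of_nonneg_right e2 hΔ0.le
    have e4 : h₂ * Δ ≤ a * (h₂ * Δ) := le_mul_of_one_le_left (by positivity) ha
    nlinarith [e1, e3, e4]
  have t2 : 2 * (Δ / c) * (h₂ * a) ≤ K / 80 := by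
    have e : 2 * (Δ / c) * (h₂ * a) = K * (2 / c) := by rw [hK]; field_simp
    rw [e]
    exact mul_div_le_div80 hK0 hc (by linarith)
  have t3 : 2 * (Δ / c) * (hp * Δ) ≤ K / 80 := by
    have e1 : 2 * (Δ / c) * (hp * Δ) ≤ 2 * (Δ / c) * (a * h₂) := by
      refine mul_le_mul_of_nonneg_left ?_ (by positivity)
      linarith
    have e : 2 * (Δ / c) * (a * h₂) = K * (2 / c) := by rw [hK]; field_simp
    have e2 := mul_div_le_div80 (k := 2) hK0 hc (by linarith)
    linarith
  have t4 : 2 * (Δ / c) * (25 * a * b) ≤ K / 80 := by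
    have hΔh₂ : Δ ≤ h₂ := hΔY.trans hYh₂
    have e1 : 2 * (Δ / c) * (25 * a * b) ≤ 2 * (Δ / c) * (25 * a * h₂) := by
      refine mul_le_mul_of_nonneg_left ?_ (by positivity)
      have : a * b ≤ a * h₂ := mul_le_mul_of_nonneg_left (hbΔ.trans hΔh₂) ha0.le
      linarith
    have e : 2 * (Δ / c) * (25 * a * h₂) = K * (50 / c) := by rw [hK]; field_simp; ring
    have e2 := mul_div_le_div80 (k := 50) hK0 hc (by linarith)
    linarith
  have t5 : Y * (a * b) / c ≤ K / 80 := by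
    have e1 : Y * (a * b) / c ≤ h₂ * (a * Δ) / c := by
      refine div_le_div_of_nonneg_right ?_ hc.le
      exact mul_le_mul hYh₂ (mul_le_mul_of_nonneg_left hbΔ ha0.le) (by positivity) hh₂0
    have e : h₂ * (a * Δ) / c = K * (1 / c) := by rw [hK]; field_simp
    have e2 := mul_div_le_div80 (k := 1) hK0 hc (by linarith)
    linarith
  have hb8 : 5 * (K / 80) ≤ a * b * h₂ / 8 := by
    rw [hK]
    have : a * Δ * h₂ ≤ 2 * (a * b * h₂) := by
      have e1 : a * Δ * h₂ = (a * h₂) * Δ := by ring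
      have e2 : 2 * (a * b * h₂) = (a * h₂) * (2 * b) := by ring
      rw [e1, e2]
      exact mul_le_mul_of_nonneg_left hΔb (by positivity)
    linarith
  linarith

/-- The accuracy budget for the FIRST (prime) form: with `50 c₁ ≤ c`, the same exponent is at most
`(Δ/c₁)(Δ hp + Δ a + Y a)`. [folklore] -/
theorem arith_P {c c₁ Δ Y a b hp hR h₂ : ℝ} (hc₁ : 1 ≤ c₁) (hc₁c : 50 * c₁ ≤ c)
    (hcΔ : c ≤ Δ) (hΔY : Δ ≤ Y) (hh₂ : h₂ ≤ Y + Δ * hp / a)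
    (ha : 1 ≤ a) (hbΔ : b ≤ Δ) (hb : 0 ≤ b) (hp0 : 0 ≤ hp) (hR0 : 0 ≤ hR) (hRh₂ : hR ≤ h₂) :
    (Δ * (hp * b + hR * a + 6 * a * b) + Y * (a * b)) / c + (hR * a + hp * b + 44 * a * b) ≤
      Δ / c₁ * (Δ * hp + Δ * a + Y * a) := by
  have hc : 0 < c := by linarith
  have hc₁0 : 0 < c₁ := by linarith
  have hΔ0 : 0 < Δ := by linarith
  have ha0 : 0 < a := by linarith
  have hY0 : 0 ≤ Y := by linarith
  have hE0 : 0 ≤ hR * a + hp * b + 44 * a * b := by positivity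
  have hexp := exponent_le (Y := Y) hc hcΔ ha0.le hbΔ hp0 hRh₂ hE0
  -- `h₂ a ≤ Y a + Δ hp`
  have hh₂a : h₂ * a ≤ Y * a + Δ * hp := by
    have e2 : h₂ * a ≤ (Y + Δ * hp / a) * a := mul_le_mul_of_nonneg_right hh₂ ha0.le
    have e3 : (Y + Δ * hp / a) * a = Y * a + Δ * hp := by field_simp
    linarith
  have hΔc0 : 0 ≤ Δ / c := by positivity
  -- `Δ/c ≤ (Δ/c₁)/50`
  have hcc₁ : Δ / c ≤ Δ / c₁ / 50 := by
    rw [div_div, div_le_div_iff_of_pos_left hΔ0 hc (by positivity)]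
    linarith
  set q : ℝ := Δ / c₁ / 50 with hq
  have hq0 : 0 ≤ q := by positivity
  have u1 : 2 * (Δ / c) * (hp * Δ) ≤ 2 * q * (hp * Δ) := by
    have : 0 ≤ hp * Δ := by positivity
    nlinarith [hcc₁, this]
  have u2 : 2 * (Δ / c) * (h₂ * a) ≤ 2 * q * (Y * a + Δ * hp) := by
    have e1 : 2 * (Δ / c) * (h₂ * a) ≤ 2 * (Δ / c) * (Y * a + Δ * hp) :=
      mul_le_mul_of_nonneg_left hh₂a (by positivity)
    have : 0 ≤ Y * a + Δ * hp := by positivity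
    nlinarith [hcc₁, this]
  have u3 : 2 * (Δ / c) * (25 * a * b) ≤ 2 * q * (25 * a * Δ) := by
    have e1 : 2 * (Δ / c) * (25 * a * b) ≤ 2 * (Δ / c) * (25 * a * Δ) := by
      refine mul_le_mul_of_nonneg_left ?_ (by positivity)
      nlinarith
    have : 0 ≤ 25 * a * Δ := by positivity
    nlinarith [hcc₁, this]
  have u4 : Y * (a * b) / c ≤ q * (Y * a) := by
    have e1 : Y * (a * b) / c ≤ Y * (a * Δ) / c :=
      div_le_div_of_nonneg_right (mul_le_mul_of_nonneg_left
        (mul_le_mul_of_nonneg_left hbΔ ha0.le) hY0) hc.le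
    have e2 : Y * (a * Δ) / c = Δ / c * (Y * a) := by field_simp
    have e3 : Δ / c * (Y * a) ≤ q * (Y * a) := mul_le_mul_of_nonneg_right hcc₁ (by positivity)
    linarith
  have hfin : 2 * q * (hp * Δ) + 2 * q * (Y * a + Δ * hp) + 2 * q * (25 * a * Δ) + q * (Y * a) ≤
      Δ / c₁ * (Δ * hp + Δ * a + Y * a) := by
    have e : Δ / c₁ = 50 * q := by rw [hq]; ring
    rw [e]
    have : 0 ≤ q * (hp * Δ) := by positivity
    have : 0 ≤ q * (Y * a) := by positivity
    nlinarith
  linarith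

/-- The height budget: `b h(𝔭) + a h(R) + 6ab ≤ 27 ΔY ≤ c Y Δ`. [folklore] -/
theorem height_le {c Δ Y a b hp hR h₂ : ℝ} (hc27 : 27 ≤ c) (hcΔ : c ≤ Δ) (hΔY : Δ ≤ Y)
    (hh₂ : h₂ ≤ Y + Δ * hp / a) (ha : 1 ≤ a) (haΔ : a ≤ Δ) (hbΔ : b ≤ Δ) (hb : 0 ≤ b)
    (hp10 : hp ≤ 10 * Y) (hRh₂ : hR ≤ h₂) :
    hp * b + hR * a + 6 * a * b ≤ c * Y * Δ := by
  have ha0 : 0 < a := by linarith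
  have hΔ0 : 0 ≤ Δ := by linarith
  have hY0 : 0 ≤ Y := by linarith
  have hh₂a : hR * a ≤ Y * a + Δ * hp := by
    have e1 : hR * a ≤ h₂ * a := mul_le_mul_of_nonneg_right hRh₂ ha0.le
    have e2 : h₂ * a ≤ (Y + Δ * hp / a) * a := mul_le_mul_of_nonneg_right hh₂ ha0.le
    have e3 : (Y + Δ * hp / a) * a = Y * a + Δ * hp := by field_simp
    linarith
  have e1 : hp * b ≤ 10 * Y * Δ := mul_le_mul hp10 hbΔ hb (by positivity)
  have e2 : Y * a ≤ Y * Δ := mul_le_mul_of_nonneg_left haΔ hY0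
  have e3 : Δ * hp ≤ Δ * (10 * Y) := mul_le_mul_of_nonneg_left hp10 hΔ0
  have e4 : a * b ≤ Δ * Δ := mul_le_mul haΔ hbΔ hb hΔ0
  have e5 : Δ * Δ ≤ Y * Δ := mul_le_mul_of_nonneg_right hΔY hΔ0
  have e6 : 27 * (Y * Δ) ≤ c * (Y * Δ) := mul_le_mul_of_nonneg_right hc27 (by positivity)
  nlinarith [e1, e2, e3, e4, e5, e6, hh₂a]

/-- Two small quantities times a common exponential factor stay below the target:
`x ≤ e^{u}`, `y ≤ e^{v}`, `u + E ≤ −T`, `v + E ≤ −T` give `max(x, y) e^{E} ≤ e^{−T}`. [folklore] -/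
theorem max_mul_exp_le {x y u v E T : ℝ} (hx : x ≤ exp u) (hy : y ≤ exp v) (hu : u + E ≤ -T)
    (hv : v + E ≤ -T) : max x y * exp E ≤ exp (-T) := by
  rcases le_total x y with h | h
  · rw [max_eq_right h]
    calc y * exp E ≤ exp v * exp E := mul_le_mul_of_nonneg_right hy (exp_pos E).le
      _ = exp (v + E) := (exp_add v E).symm
      _ ≤ exp (-T) := exp_le_exp.mpr hv
  · rw [max_eq_left h]
    calc x * exp E ≤ exp u * exp E := mul_le_mul_of_nonneg_right hx (exp_pos E).le
      _ = exp (u + E) := (exp_add u E).symm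
      _ ≤ exp (-T) := exp_le_exp.mpr hu

/-- The degree of the second form: `b = ⌊Δ⌋` has `a ≤ b`, `10 ≤ b`, `b ≤ Δ ≤ 2b` once `a ≤ Δ`,
`10 ≤ Δ`. [folklore] -/
theorem floor_facts {Δ : ℝ} {a : ℕ} (haΔ : (a : ℝ) ≤ Δ) (h10 : (10 : ℝ) ≤ Δ) :
    a ≤ ⌊Δ⌋₊ ∧ 10 ≤ ⌊Δ⌋₊ ∧ (⌊Δ⌋₊ : ℝ) ≤ Δ ∧ Δ ≤ 2 * (⌊Δ⌋₊ : ℝ) := by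
  have hΔ0 : 0 ≤ Δ := by linarith
  have h1 : a ≤ ⌊Δ⌋₊ := Nat.le_floor haΔ
  have h2 : 10 ≤ ⌊Δ⌋₊ := Nat.le_floor (by exact_mod_cast h10)
  have h3 : (⌊Δ⌋₊ : ℝ) ≤ Δ := Nat.floor_le hΔ0
  have h4 : Δ < (⌊Δ⌋₊ : ℝ) + 1 := Nat.lt_floor_add_one Δ
  have h5 : (10 : ℝ) ≤ (⌊Δ⌋₊ : ℝ) := by exact_mod_cast h2
  exact ⟨h1, h2, h3, by linarith⟩

/-- The adaptive height box: `N = ⌊e^{h₂}⌋` has `1 ≤ N`, `log N ≤ h₂ ≤ log (N + 1)` for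
`h₂ ≥ 0`. [folklore] -/
theorem box_facts {h₂ : ℝ} (hh₂ : 0 ≤ h₂) :
    1 ≤ ⌊exp h₂⌋₊ ∧ Real.log (⌊exp h₂⌋₊ : ℕ) ≤ h₂ ∧ h₂ ≤ Real.log ((⌊exp h₂⌋₊ : ℕ) + 1) := by
  have he1 : (1 : ℝ) ≤ exp h₂ := one_le_exp hh₂
  have hN1 : 1 ≤ ⌊exp h₂⌋₊ := Nat.le_floor (by exact_mod_cast he1)
  have hNle : (⌊exp h₂⌋₊ : ℝ) ≤ exp h₂ := Nat.floor_le (exp_pos h₂).le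
  have hNlt : exp h₂ < (⌊exp h₂⌋₊ : ℝ) + 1 := Nat.lt_floor_add_one _
  have hN0 : (0 : ℝ) < (⌊exp h₂⌋₊ : ℝ) := by exact_mod_cast hN1
  refine ⟨hN1, ?_, ?_⟩
  · calc Real.log (⌊exp h₂⌋₊ : ℕ) ≤ Real.log (exp h₂) := log_le_log hN0 hNle
      _ = h₂ := log_exp h₂
  · calc h₂ = Real.log (exp h₂) := (log_exp h₂).symm
      _ ≤ Real.log ((⌊exp h₂⌋₊ : ℕ) + 1) := log_le_log (exp_pos h₂) hNlt.le

/-- An associated prime contains the ideal. [folklore] -/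
theorem le_of_mem_associatedPrimes {R : Type*} [CommRing R] {J 𝔮 : Ideal R}
    (h : 𝔮 ∈ J.associatedPrimes) : J ≤ 𝔮 := by
  obtain ⟨x, hx⟩ := h.2
  rw [hx]
  intro y hy
  refine Ideal.le_radical ?_
  rw [Submodule.mem_colon_singleton, smul_eq_mul]
  exact J.mul_mem_right x hy

/-- `V` is antitone: `J ≤ 𝔮` gives `V(𝔮) ⊆ V(J)`. [folklore] -/
theorem projZeros_antitone {m : ℕ} {J 𝔮 : Ideal (Rx m)} (h : J ≤ 𝔮) : projZeros 𝔮 ⊆ projZeros J :=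
  fun _ hβ => ⟨hβ.1, fun P hP => hβ.2 P (h hP)⟩

end CycleAPITwo

/-- **Registered sub-goal `stub_cycleAPI_two_lemmas`** (crux `stmt-Schanuel-6117`, line
`orbit-interpolation-determinant`; the part of stub F carried by this helper file): the accuracy budget
of the second form with the adaptive height (`CycleAPITwo.arith_R`). [folklore] -/
theorem stub_cycleAPI_two_lemmas : ∀ (c c₂ Δ Y a b hp hR h₂ : ℝ), 0 < c₂ → 80 * c₂ ≤ c → 4000 ≤ c → c ≤ Δ → Δ ≤ Y → Y ≤ h₂ → Δ * hp ≤ a * h₂ → 1 ≤ a → b ≤ Δ → Δ ≤ 2 * b → 0 ≤ hp → 0 ≤ hR → hR ≤ h₂ → (Δ * (hp * b + hR * a + 6 * a * b) + Y * (a * b)) / c + (hR * a + hp * b + 44 * a * b) + c₂ * b ≤ a * b * h₂ / 8 :=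
  fun _ _ _ _ _ _ _ _ _ => CycleAPITwo.arith_R

end Summit.Schanuel.Schanuel.Cruxes.ApproximationProperty.OrbitInterpolationDeterminant

end
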